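import Summits.CriticalPhenomena.CardyFormulaZ2.Theorems.CardyFlipRussoVoronoiHubFromSmirnovDefs

/-!
# Stub `poisson_count_tail_le` of line `moebius-exact-delaunay-dilation-ward`
# (crux `VoronoiHubFromSmirnov`, stmt-CriticalPhenomena-6433)

The Poisson count tail used when counting "potential defects" of the conformal transport over a
grid of discretised navels (I. Benjamini, O. Schramm, *Conformal invariance of Voronoi
percolation*, Comm. Math. Phys. 197 (1998) 75–107, Prop. 5.3): for a Poisson point process `P`
on `ℂ` with intensity `ν` and a measurable region `s` of finite intensity,
`P(N(s) ≥ k) ≤ ν(s)^k / k!` for every `k : ℕ`.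

Proof. Let `r := (ν s).toNNReal`, so that `N(s) ~ Po(r)` (`IsPoissonPointProcess.map_count`)
and `(r : ℝ) = (ν s).toReal`. Pushing the event `{N(s) ≥ k}` forward along `c ↦ N_c(s)` and then
along `ℕ → ℕ∞` identifies `P {N(s) ≥ k}` with `Po(r) (Ici k) = ∑_{n ≥ 0} Po(r) {n + k}`
(`Measure.tsum_indicator_apply_singleton`, `Summable.sum_add_tsum_nat_add'`). Termwise,
`e^{-r} r^{n+k} / (n+k)! ≤ (e^{-r} rⁿ / n!) · (rᵏ / k!)` because `n! k! ≤ (n+k)!`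
(`Nat.factorial_mul_factorial_dvd_factorial_add`), and `∑ₙ e^{-r} rⁿ / n! = 1`
(`hasSum_one_poissonMeasure`), whence `Po(r) (Ici k) ≤ rᵏ / k!` in `ℝ≥0∞` and the real-valued
bound follows (`ENNReal.toReal_le_of_le_ofReal`).

No new definitions; tree facts and Mathlib only.
-/

noncomputable section

namespace Summit.CriticalPhenomena.CardyFormulaZ2.Cruxes.VoronoiHubFromSmirnov.MoebiusExactDelaunayDilationWard

open MeasureTheory ProbabilityTheory Literature.Analysis.FunctionSpaces
open scoped ENNReal NNReal

/-- Termwise comparison of shifted Poisson weights: `e^{-r} r^{n+k}/(n+k)! ≤ (e^{-r} rⁿ/n!) · rᵏ/k!`,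
from `n! k! ≤ (n+k)!`. -/
theorem pct_poissonTerm_add_le (r : ℝ≥0) (k n : ℕ) :
    Real.exp (-(r : ℝ)) * (r : ℝ) ^ (n + k) / ((n + k).factorial : ℝ) ≤
      Real.exp (-(r : ℝ)) * (r : ℝ) ^ n / (n.factorial : ℝ) * ((r : ℝ) ^ k / (k.factorial : ℝ)) := by
  have hfac : (n.factorial : ℝ) * (k.factorial : ℝ) ≤ ((n + k).factorial : ℝ) := by
    exact_mod_cast Nat.le_of_dvd (Nat.factorial_pos _)
      (Nat.factorial_mul_factorial_dvd_factorial_add n k)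
  have hpos : (0 : ℝ) < (n.factorial : ℝ) * (k.factorial : ℝ) := by positivity
  calc Real.exp (-(r : ℝ)) * (r : ℝ) ^ (n + k) / ((n + k).factorial : ℝ)
      ≤ Real.exp (-(r : ℝ)) * (r : ℝ) ^ (n + k) / ((n.factorial : ℝ) * (k.factorial : ℝ)) :=
        div_le_div_of_nonneg_left (by positivity) hpos hfac
    _ = Real.exp (-(r : ℝ)) * (r : ℝ) ^ n / (n.factorial : ℝ) *
          ((r : ℝ) ^ k / (k.factorial : ℝ)) := by
        rw [pow_add, div_mul_div_comm, mul_assoc]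

/-- The Poisson law as a series over a set: `Po(r) S = ∑ₙ 𝟙_S(n) Po(r) {n}`. -/
theorem pct_poissonMeasure_eq_tsum_indicator (r : ℝ≥0) (S : Set ℕ) :
    poissonMeasure r S = ∑' n, S.indicator (fun n => poissonMeasure r {n}) n :=
  (Measure.tsum_indicator_apply_singleton _ S (MeasurableSet.of_discrete)).symm

/-- The Poisson upper tail as a shifted series: `Po(r) (Ici k) = ∑ₙ Po(r) {n + k}`. -/
theorem pct_poissonMeasure_Ici_eq_tsum (r : ℝ≥0) (k : ℕ) :
    poissonMeasure r (Set.Ici k) = ∑' n, poissonMeasure r {n + k} := by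
  rw [pct_poissonMeasure_eq_tsum_indicator,
    ← Summable.sum_add_tsum_nat_add' (f := (Set.Ici k).indicator fun n => poissonMeasure r {n})
      (k := k) ENNReal.summable]
  have h0 : ∑ i ∈ Finset.range k, (Set.Ici k).indicator (fun n => poissonMeasure r {n}) i = 0 :=
    Finset.sum_eq_zero fun i hi =>
      Set.indicator_of_notMem (by simpa using hi) _
  rw [h0, zero_add]
  exact tsum_congr fun n => Set.indicator_of_mem (by simp) _

/-- **Poisson tail bound** in `ℝ≥0∞`: `Po(r) (Ici k) ≤ rᵏ / k!`. -/
theorem pct_poissonMeasure_Ici_le (r : ℝ≥0) (k : ℕ) :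
    poissonMeasure r (Set.Ici k) ≤ ENNReal.ofReal ((r : ℝ) ^ k / (k.factorial : ℝ)) := by
  have hsum : HasSum (fun n : ℕ => Real.exp (-(r : ℝ)) * (r : ℝ) ^ n / (n.factorial : ℝ) *
      ((r : ℝ) ^ k / (k.factorial : ℝ))) (1 * ((r : ℝ) ^ k / (k.factorial : ℝ))) :=
    (hasSum_one_poissonMeasure r).mul_right _
  calc poissonMeasure r (Set.Ici k)
      = ∑' n, poissonMeasure r {n + k} := pct_poissonMeasure_Ici_eq_tsum r k
    _ ≤ ∑' n : ℕ, ENNReal.ofReal (Real.exp (-(r : ℝ)) * (r : ℝ) ^ n / (n.factorial : ℝ) *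
          ((r : ℝ) ^ k / (k.factorial : ℝ))) :=
        ENNReal.tsum_le_tsum fun n => by
          rw [poissonMeasure_singleton]
          exact ENNReal.ofReal_le_ofReal (pct_poissonTerm_add_le r k n)
    _ = ENNReal.ofReal (∑' n : ℕ, Real.exp (-(r : ℝ)) * (r : ℝ) ^ n / (n.factorial : ℝ) *
          ((r : ℝ) ^ k / (k.factorial : ℝ))) :=
        (ENNReal.ofReal_tsum_of_nonneg (fun n => by positivity) hsum.summable).symm
    _ = ENNReal.ofReal ((r : ℝ) ^ k / (k.factorial : ℝ)) := by
        rw [hsum.tsum_eq, one_mul]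

/-- The tail event `{N(s) ≥ k}` is the preimage of `Ici k` under the counting map. -/
theorem pct_setOf_le_count_eq (s : Set ℂ) (k : ℕ) :
    {c : PointConfig ℂ | (k : ℕ∞) ≤ c.count s} = (fun c => c.count s) ⁻¹' Set.Ici (k : ℕ∞) :=
  rfl

/-- The preimage of `Ici (k : ℕ∞)` under `ℕ → ℕ∞` is `Ici k`. -/
theorem pct_natCast_preimage_Ici (k : ℕ) :
    ((↑) : ℕ → ℕ∞) ⁻¹' Set.Ici (k : ℕ∞) = Set.Ici k := by
  ext n
  simp

/-- For a Poisson process, `P {N(s) ≥ k} = Po(ν s) (Ici k)` for measurable `s` of finite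
intensity (`IsPoissonPointProcess.map_count`). -/
theorem pct_measure_le_count_eq {ν : Measure ℂ} {P : Measure (PointConfig ℂ)}
    (hP : IsPoissonPointProcess ν P) {s : Set ℂ} (hs : MeasurableSet s) (hν : ν s ≠ ⊤) (k : ℕ) :
    P {c : PointConfig ℂ | (k : ℕ∞) ≤ c.count s} = poissonMeasure (ν s).toNNReal (Set.Ici k) := by
  rw [pct_setOf_le_count_eq,
    ← Measure.map_apply (PointConfig.measurable_count hs) MeasurableSet.of_discrete,
    hP.map_count hs hν, Measure.map_apply measurable_from_top MeasurableSet.of_discrete,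
    pct_natCast_preimage_Ici]

/-- **Poisson count tail** (Benjamini–Schramm 1998, input to Prop. 5.3): for a Poisson point
process `P` on `ℂ` with intensity `ν`, a measurable `s` with `ν s < ∞` and `k : ℕ`,
`P(N(s) ≥ k) ≤ ν(s)^k / k!`. -/
theorem poisson_count_tail_le : ∀ {ν : MeasureTheory.Measure ℂ} {P : MeasureTheory.Measure (Literature.Analysis.FunctionSpaces.PointConfig ℂ)}, Literature.Analysis.FunctionSpaces.IsPoissonPointProcess ν P → ∀ {s : Set ℂ}, MeasurableSet s → ν s ≠ ⊤ → ∀ k : ℕ, P.real {c | (k : ℕ∞) ≤ c.count s} ≤ (ν s).toReal ^ k / (k.factorial : ℝ) := by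
  intro ν P hP s hs hν k
  rw [measureReal_def, pct_measure_le_count_eq hP hs hν k]
  exact ENNReal.toReal_le_of_le_ofReal (by positivity) (pct_poissonMeasure_Ici_le (ν s).toNNReal k)

end Summit.CriticalPhenomena.CardyFormulaZ2.Cruxes.VoronoiHubFromSmirnov.MoebiusExactDelaunayDilationWard

end
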